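import Summits.SmoothPoincare4.SmoothPoincare4.Theses.DottedCircleRasmussen
import Summits.SmoothPoincare4.SmoothPoincare4.Theses.SchoenfliesSplit
import Literature.Topology.FourManifolds.HomotopyBallSliceSphereProofs
import Literature.Topology.FourManifolds.HomotopyS4CompactProofs
import Literature.Topology.FourManifolds.HomotopyS4OrientableProofs
import Literature.Topology.FourManifolds.BordismMerging
import Literature.Topology.FourManifolds.GluckTwistProofs

/-!
# Stub `stub_invOfSchsplit` (P2) of line `Sketch` for crux `DottedCircleRasmussen.DcrRigidity`
(item stmt-SmoothPoincare4-17014, route route-SmoothPoincare4-DottedCircleRasmussen)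

**Packaging the other route's crux.** Crux (A) of route `SchoenfliesSplit`,
`SchsplitPuncturedEmbeds` (item stmt-SmoothPoincare4-0371: every punctured homotopy 4-sphere
`S ∖ {p}`, `S : HomotopySphere 4` — compact, oriented, `≃ₕ S⁴` — embeds smoothly in `ℝ⁴`), is
re-read for the route's `Type`-binder homotopy spheres: for a Hausdorff second-countable smooth
4-manifold `M : Type` with `M ≃ₕ S⁴` and any `q : M`, the puncture `M ∖ {q}` (the open submanifold
`{q}ᶜ`) embeds smoothly in `S⁴`.

Proof. `CompactSpace M` and an orientation of `M` come from the landed facts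
`compactSpace_of_homotopyEquiv_sphere_four_holds` (Hatcher Prop. 3.29) and
`isOrientable_of_homotopyEquiv_sphere_four_holds` (Lee Thm. 15.43), so `⟨M, o, ⟨h⟩⟩ : HomotopySphere 4`
and the hypothesis gives a smooth embedding `g : M ∖ {q} ↪ ℝ⁴`. Its range is open (invariance of
domain for equidimensional smooth embeddings, `Manifold.IsSmoothEmbedding.isOpenMap_of_finrank_eq`),
so it composes (`IsSmoothEmbedding.comp_of_isOpen_range`) with the round ball
`σ₋ₐ⁻¹ : ℝ⁴ ↪ S⁴`, the inverse of the stereographic chart of `S⁴` at a point `a`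
(`isSmoothEmbedding_stereographic'_symm`).

References: M. Freedman, R. Gompf, S. Morrison, K. Walker, Quantum Topol. 1 (2010), §1 fn. 1
(SPC4 ⟺ invertibility ∧ Schoenflies⁴) [FreedmanGompfMorrisonWalker2010]; J. M. Lee,
*Introduction to Smooth Manifolds*, 2nd ed. (2013), Ch. 4–5 [LeeSmoothManifolds2013].
No `sorry`, no named facts beyond the hypothesis `SchsplitPuncturedEmbeds`.
-/

noncomputable section

set_option linter.dupNamespace false

open scoped Manifold ContDiff Topology ContinuousMap
open Set Function Metric
open Literature.Topology.FourManifolds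
open Summit.SmoothPoincare4.SmoothPoincare4.Theses.DottedCircleRasmussen
open Summit.SmoothPoincare4.SmoothPoincare4.Theses.SchoenfliesSplit (SchsplitPuncturedEmbeds)

namespace Summit.SmoothPoincare4.SmoothPoincare4.Cruxes.DcrRigidity.Sketch

local notation "𝔼⁴" => EuclideanSpace ℝ (Fin 4)
local notation "𝔼²" => EuclideanSpace ℝ (Fin 2)
local notation "𝕊¹" => (Metric.sphere (0 : EuclideanSpace ℝ (Fin 2)) 1)
local notation "𝕊⁴" => (Metric.sphere (0 : EuclideanSpace ℝ (Fin 5)) 1)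

/-! ## The round ball composed with an equidimensional embedding -/

/-- **Into `S⁴` through `ℝ⁴`.** A smooth embedding `g : X ↪ ℝ⁴` of a (boundaryless) smooth
4-manifold has open range (invariance of domain), hence composes with the round ball
`σ₋ₐ⁻¹ : ℝ⁴ ↪ S⁴` (inverse stereographic chart at `a = e₀`) to a smooth embedding `X ↪ S⁴`.
[folklore] -/
theorem invOfSchsplit_isSmoothEmbedding_sphere_of_euclidean
    {X : Type*} [TopologicalSpace X] [ChartedSpace 𝔼⁴ X] [IsManifold (𝓡 4) ∞ X]
    {g : X → 𝔼⁴} (hg : Manifold.IsSmoothEmbedding (𝓡 4) (𝓡 4) ∞ g) :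
    ∃ ι : X → 𝕊⁴, Manifold.IsSmoothEmbedding (𝓡 4) (𝓡 4) ∞ ι := by
  letI := Knot.fact_finrank_euclideanSpace_four_add_one
  obtain ⟨a⟩ : Nonempty 𝕊⁴ := ⟨⟨EuclideanSpace.single 0 1, by simp⟩⟩
  have hσ := isSmoothEmbedding_stereographic'_symm (n := 4) a
  have hgo : IsOpen (range g) :=
    (Manifold.IsSmoothEmbedding.isOpenMap_of_finrank_eq hg rfl).isOpen_range
  exact ⟨_, IsSmoothEmbedding.comp_of_isOpen_range hσ hg hgo⟩

/-! ## Stub P2 -/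

/-- **P2 (`InvOfSchsplit`).** Crux (A) of route `SchoenfliesSplit` — every punctured homotopy
4-sphere (`HomotopySphere 4`: compact, oriented, `≃ₕ S⁴`) embeds smoothly in `ℝ⁴` — gives, for every
homotopy 4-sphere in the route's `Type`-binder form and every point `q`, a smooth embedding of
`M ∖ {q}` into `S⁴`: `CompactSpace M` and an orientation come from the landed facts
`compactSpace_of_homotopyEquiv_sphere_four_holds` / `isOrientable_of_homotopyEquiv_sphere_four_holds`,
and `M ∖ {q} ↪ ℝ⁴` (open range, invariance of domain) is composed with the inverse stereographic
chart `ℝ⁴ ↪ S⁴` (`isSmoothEmbedding_stereographic'_symm`, `IsSmoothEmbedding.comp_of_isOpen_range`).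
[cite: FreedmanGompfMorrisonWalker2010, §1 fn. 1] -/
theorem stub_invOfSchsplit (hA : SchsplitPuncturedEmbeds)
    (M : Type) [TopologicalSpace M] [T2Space M] [SecondCountableTopology M]
    [ChartedSpace 𝔼⁴ M] [IsManifold (𝓡 4) ∞ M] (hM : Nonempty (M ≃ₕ 𝕊⁴)) (q : M) :
    ∃ ι : ↥((⟨{q}ᶜ, isOpen_compl_singleton⟩ : TopologicalSpace.Opens M)) → 𝕊⁴,
      Manifold.IsSmoothEmbedding (𝓡 4) (𝓡 4) ∞ ι := by
  obtain ⟨h⟩ := hM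
  haveI : CompactSpace M := compactSpace_of_homotopyEquiv_sphere_four_holds M h
  obtain ⟨o⟩ := isOrientable_of_homotopyEquiv_sphere_four_holds M h
  obtain ⟨g, hg⟩ := hA ⟨M, o, ⟨h⟩⟩ q
  exact invOfSchsplit_isSmoothEmbedding_sphere_of_euclidean hg

end Summit.SmoothPoincare4.SmoothPoincare4.Cruxes.DcrRigidity.Sketch

end
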